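import Mathlib.Analysis.SpecialFunctions.Pow.Real
import Mathlib.Analysis.SpecialFunctions.Log.Basic
import Mathlib.Analysis.Complex.ExponentialBounds
import Mathlib.Data.Nat.Factorial.Basic
import HarnessLib

/-!
# Brownawell–Waldschmidt: elementary inequalities for the parameters

`Literature/NumberTheory/Transcendental/BWParams.lean` — small real-analysis lemmas used to
compare the explicit bounds of the level-`s` construction (`BWConstruction.lean`) with the
sequences `δ_s = κ₁ s²`, `σ_s = κ₂ s² log s` of Gelfond's criterion (`BWMain.lean`). Nothing here
is specific to transcendence: logarithms of products and powers, `log s ≤ s`, the decay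
`(3/(s-1))^{N} ≤ exp(-N (log s)/2)` for `s ≥ 16`, absorption of lower-order terms
(`K s³ ≤ ε s⁴ log s` for large `s`), and the growth conditions `(s+1)² ≤ 2 s²`,
`(s+1)² log(s+1) < 2 s² log s` (`s ≥ 8`).

## References

* [BakerTNT1975] A. Baker, *Transcendental Number Theory*, CUP (1975), Ch. 12 §5 (the
  comparison "`n ≤ k(log k)^{1/2}`, `log h ≤ k log k`, `log|P(ω)| ≤ -k²(log k)^{…}`").
-/

noncomputable section

open Real

namespace Literature.NumberTheory.Transcendental.BrownawellWaldschmidt.Params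

/-! ### Logarithms -/

/-- `log s ≥ 1` for `s ≥ 3`. [folklore] -/
lemma one_le_log {s : ℝ} (hs : 3 ≤ s) : 1 ≤ Real.log s := by
  have h : Real.exp 1 ≤ s := le_trans (le_of_lt Real.exp_one_lt_d9) (by norm_num at hs ⊢; linarith)
  calc (1 : ℝ) = Real.log (Real.exp 1) := (Real.log_exp 1).symm
    _ ≤ Real.log s := Real.log_le_log (Real.exp_pos 1) h

/-- `log x ≤ x` for `x ≥ 0`: this is Mathlib's `Real.log_le_self`, to be used directly; unused
deprecated restatement (dedup-00607). [folklore] -/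
@[deprecated Real.log_le_self (since := "2026-08-15")]
lemma log_le_self' {x : ℝ} (hx : 0 ≤ x) : Real.log x ≤ x := Real.log_le_self hx

/-- `log (c · s^k) = log c + k log s` for `c > 0`, `s > 0`. [folklore] -/
lemma log_const_mul_pow {c s : ℝ} (hc : 0 < c) (hs : 0 < s) (k : ℕ) :
    Real.log (c * s ^ k) = Real.log c + k * Real.log s := by
  rw [Real.log_mul hc.ne' (pow_pos hs k).ne', Real.log_pow]

/-- `log (c · s^k) ≤ (|log c| + k) · log s` for `s ≥ 3` (`log s ≥ 1`), `c > 0`. [folklore] -/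
lemma log_const_mul_pow_le {c s : ℝ} (hc : 0 < c) (hs : 3 ≤ s) (k : ℕ) :
    Real.log (c * s ^ k) ≤ (|Real.log c| + k) * Real.log s := by
  have hs0 : 0 < s := by linarith
  have hl := one_le_log hs
  rw [log_const_mul_pow hc hs0 k, add_mul]
  have : Real.log c ≤ |Real.log c| * Real.log s := by
    calc Real.log c ≤ |Real.log c| := le_abs_self _
      _ = |Real.log c| * 1 := (mul_one _).symm
      _ ≤ |Real.log c| * Real.log s := mul_le_mul_of_nonneg_left hl (abs_nonneg _)
  linarith

/-- `log (1 + x) ≤ log 2 + log x` for `x ≥ 1`. [folklore] -/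
lemma log_one_add_le {x : ℝ} (hx : 1 ≤ x) : Real.log (1 + x) ≤ Real.log 2 + Real.log x := by
  rw [← Real.log_mul (by norm_num) (by linarith)]
  exact Real.log_le_log (by linarith) (by linarith)

/-! ### The decay factor -/

/-- `3/(s-1) ≤ s^{-1/2}`, i.e. `3 √s ≤ s - 1`, for `s ≥ 16`. [folklore] -/
lemma three_div_le_inv_sqrt {s : ℝ} (hs : 16 ≤ s) : 3 / (s - 1) ≤ 1 / Real.sqrt s := by
  have hs0 : 0 < s := by linarith
  have hsq : 4 ≤ Real.sqrt s := by
    rw [show (4 : ℝ) = Real.sqrt 16 by rw [show (16 : ℝ) = 4 ^ 2 by norm_num,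
      Real.sqrt_sq (by norm_num)]]
    exact Real.sqrt_le_sqrt hs
  have hsqpos : 0 < Real.sqrt s := by linarith
  rw [div_le_div_iff₀ (by linarith) hsqpos, one_mul]
  have hss : Real.sqrt s * Real.sqrt s = s := Real.mul_self_sqrt hs0.le
  nlinarith

/-- **The decay**: `(3/(s-1))^N ≤ exp(-(N/2) log s)` for `s ≥ 16`. [folklore] -/
lemma decay_pow_le {s : ℝ} (hs : 16 ≤ s) (N : ℕ) :
    (3 / (s - 1)) ^ N ≤ Real.exp (-((N : ℝ) / 2 * Real.log s)) := by
  have hs0 : 0 < s := by linarith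
  have h3 : 0 ≤ 3 / (s - 1) := div_nonneg (by norm_num) (by linarith)
  have h1 := three_div_le_inv_sqrt hs
  calc (3 / (s - 1)) ^ N ≤ (1 / Real.sqrt s) ^ N := pow_le_pow_left₀ h3 h1 N
    _ = Real.exp (-((N : ℝ) / 2 * Real.log s)) := by
        rw [one_div, inv_pow, ← Real.exp_log (pow_pos (Real.sqrt_pos.mpr hs0) N), ← Real.exp_neg]
        congr 1
        rw [Real.log_pow, Real.log_sqrt hs0.le]
        ring

/-! ### Absorbing lower-order terms -/

/-- `K ≤ ε s log s` once `s ≥ 3` and `s ≥ K/ε` (`ε > 0`, `K ≥ 0`). [folklore] -/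
lemma const_le_eps_mul_s_log {K ε s : ℝ} (hε : 0 < ε) (hs : 3 ≤ s)
    (hsK : K / ε ≤ s) : K ≤ ε * s * Real.log s := by
  have hl := one_le_log hs
  have h1 : K ≤ ε * s := by rwa [div_le_iff₀' hε] at hsK
  calc K ≤ ε * s := h1
    _ = ε * s * 1 := (mul_one _).symm
    _ ≤ ε * s * Real.log s := by
        apply mul_le_mul_of_nonneg_left hl
        exact mul_nonneg hε.le (by linarith)

/-- `K s³ ≤ ε s⁴ log s` once `s ≥ 3` and `s ≥ K/ε`. [folklore] -/
lemma cube_le_eps_quartic_log {K ε s : ℝ} (hε : 0 < ε) (hs : 3 ≤ s)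
    (hsK : K / ε ≤ s) : K * s ^ 3 ≤ ε * s ^ 4 * Real.log s := by
  have h := const_le_eps_mul_s_log hε hs hsK
  have hs3 : 0 ≤ s ^ 3 := by positivity
  calc K * s ^ 3 ≤ (ε * s * Real.log s) * s ^ 3 := mul_le_mul_of_nonneg_right h hs3
    _ = ε * s ^ 4 * Real.log s := by ring

/-- `K s² log s ≤ ε s⁴ log s` once `s ≥ 3` and `s² ≥ K/ε`. [folklore] -/
lemma sq_log_le_eps_quartic_log {K ε s : ℝ} (hε : 0 < ε) (hs : 3 ≤ s)
    (hsK : K / ε ≤ s ^ 2) : K * s ^ 2 * Real.log s ≤ ε * s ^ 4 * Real.log s := by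
  have hl : 0 ≤ Real.log s := le_trans zero_le_one (one_le_log hs)
  have h1 : K ≤ ε * s ^ 2 := by rwa [div_le_iff₀' hε] at hsK
  calc K * s ^ 2 * Real.log s ≤ (ε * s ^ 2) * s ^ 2 * Real.log s := by
        gcongr
    _ = ε * s ^ 4 * Real.log s := by ring

/-- `K s² ≤ ε s² log s` once `log s ≥ K/ε` (`s > 0`). [folklore] -/
lemma sq_le_eps_sq_log {K ε s : ℝ} (hε : 0 < ε) (hs : 0 < s)
    (hsK : K / ε ≤ Real.log s) : K * s ^ 2 ≤ ε * s ^ 2 * Real.log s := by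
  have h1 : K ≤ ε * Real.log s := by rwa [div_le_iff₀' hε] at hsK
  have hs2 : 0 ≤ s ^ 2 := by positivity
  calc K * s ^ 2 ≤ (ε * Real.log s) * s ^ 2 := mul_le_mul_of_nonneg_right h1 hs2
    _ = ε * s ^ 2 * Real.log s := by ring

/-- `log s ≤ s²` (for `s ≥ 0`). [folklore] -/
lemma log_le_sq {s : ℝ} (hs : 1 ≤ s) : Real.log s ≤ s ^ 2 := by
  calc Real.log s ≤ s := Real.log_le_self (by linarith)
    _ ≤ s ^ 2 := by nlinarith

/-! ### Growth of the sequences of Gelfond's criterion -/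

/-- `(s+1)² ≤ 2 s²` for `s ≥ 3`. [folklore] -/
lemma succ_sq_le_two_mul_sq {s : ℝ} (hs : 3 ≤ s) : (s + 1) ^ 2 ≤ 2 * s ^ 2 := by nlinarith

/-- `log (s+1) ≤ log s + 1/s` for `s > 0`. [folklore] -/
lemma log_succ_le {s : ℝ} (hs : 0 < s) : Real.log (s + 1) ≤ Real.log s + 1 / s := by
  have h : Real.log (s + 1) - Real.log s = Real.log (1 + 1 / s) := by
    rw [← Real.log_div (by linarith) hs.ne']
    congr 1
    field_simp
  have h2 : Real.log (1 + 1 / s) ≤ 1 / s := by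
    have := Real.log_le_sub_one_of_pos (show 0 < 1 + 1 / s by positivity)
    linarith
  linarith

/-- `(s+1)² log(s+1) < 2 s² log s` for `s ≥ 8`. [folklore] -/
lemma succ_sq_log_lt {s : ℝ} (hs : 8 ≤ s) :
    (s + 1) ^ 2 * Real.log (s + 1) < 2 * (s ^ 2 * Real.log s) := by
  have hs0 : 0 < s := by linarith
  have hl : 2 ≤ Real.log s := by
    have h8 : Real.log 8 ≤ Real.log s := Real.log_le_log (by norm_num) hs
    have : (2 : ℝ) ≤ Real.log 8 := by
      rw [show (8 : ℝ) = 2 ^ 3 by norm_num, Real.log_pow]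
      have := Real.log_two_gt_d9
      push_cast
      linarith
    linarith
  have h1 := log_succ_le hs0
  have hpos : 0 < (s + 1) ^ 2 := by positivity
  calc (s + 1) ^ 2 * Real.log (s + 1) ≤ (s + 1) ^ 2 * (Real.log s + 1 / s) :=
        mul_le_mul_of_nonneg_left h1 hpos.le
    _ = (s + 1) ^ 2 * Real.log s + (s + 1) ^ 2 / s := by ring
    _ < 2 * (s ^ 2 * Real.log s) := by
        have h3 : (s + 1) ^ 2 / s ≤ 2 * s := by
          rw [div_le_iff₀ hs0]; nlinarith
        have h4 : 0 ≤ s ^ 2 - 2 * s - 1 := by nlinarith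
        nlinarith [mul_le_mul_of_nonneg_left hl h4]

/-- The final gap: if `a² > 320 κ₁ κ₂` then `-(a²/4) X < -80 κ₁ κ₂ X` for `X > 0`. [folklore] -/
lemma final_gap {a2 κ₁ κ₂ X : ℝ} (h : 320 * κ₁ * κ₂ < a2) (hX : 0 < X) :
    -(a2 / 4 * X) < -(80 * (κ₁ * κ₂) * X) := by nlinarith

end Literature.NumberTheory.Transcendental.BrownawellWaldschmidt.Params

end
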